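import Literature.NumberTheory.EllipticCurves.ModularSymbolsHeckeProofs
import HarnessLib

/-!
# `{∞, 0}_f = 2π N^{-1/2} Λ_N(f, 1)` and `[0]⁺_f = L(f, 1)/Ω⁺_f`: the modular symbol at `0`

This file discharges, sorry-free, the named fact `Literature.NumberTheory.EllipticCurves.ModularForms.normalizedPlusSymbol_zero`
(last section, see below) and the named fact
`Literature.NumberTheory.EllipticCurves.ModularForms.modularSymbol_zero_eq_of_mem_completedCuspFormLContinuations` of
`Literature.NumberTheory.EllipticCurves.ModularSymbols` (trunk EllArithM, item C9): for a
weight-`2` cusp form `f ∈ S₂(Γ₀(N))` and *every* entire continuation `Λ` of the completed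
`L`-function `Λ_N(f, s) = N^{s/2} (2π)^{-s} Γ(s) L(f, s)` (the set
`completedCuspFormLContinuations N f` of `Literature.NumberTheory.EllipticCurves.CuspFormLFunction`),

  `{∞, 0}_f = modularSymbol f 0 = 2π N^{-1/2} Λ(1)`.

Source (Cremona, *Algorithms for modular elliptic curves*, 2nd ed., §2.8): the `L`-function of
`f` is the Mellin transform `L(f, s) = (2π)^s Γ(s)⁻¹ ∫₀^{i∞} (-iz)^s f(z) dz/z` (2.8.1), "an entire
function of `s`", equal to `∑ a(n, f) n⁻ˢ` (2.8.2) where the series converges absolutely;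
`Λ(f, s) = N^{s/2} (2π)^{-s} Γ(s) L(f, s)` (2.8.5); and "substituting `s = 1` into (2.8.1) we
obtain `L(f, 1) = -2πi ∫₀^{i∞} f(z) dz = -⟨{0, ∞}, f⟩`", i.e. `{∞, 0}_f = L(f, 1)`, whence
`{∞, 0}_f = 2π N^{-1/2} Λ(f, 1)` since `Γ(1) = 1`.

## Proof

The sibling `Literature.NumberTheory.EllipticCurves.ModularSymbolsHeckeProofs` already proves
`modularSymbol_zero_eq_holds`: `{∞, 0}_f = L(1)` for every entire `L` with `L(s) = L(f, s)` on
`re s > 2` (Hecke's continuation along the imaginary axis plus the identity theorem). Given an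
entire continuation `Λ` of `Λ_N(f, s)`, the function
`L(s) := N^{-s/2} (2π)^s Γ(s)⁻¹ Λ(s)` is entire (`1/Γ` is entire, Mathlib
`Complex.differentiable_one_div_Gamma`) and equals `L(f, s)` for `re s > 2` (there `Γ(s) ≠ 0`,
so the `Γ`-factors cancel), hence `{∞, 0}_f = L(1) = N^{-1/2} · 2π · Γ(1)⁻¹ · Λ(1) = 2π N^{-1/2} Λ(1)`.

## The normalised plus symbol at `0` (last section)

The same `modularSymbol_zero_eq_holds` also discharges the named fact
`Literature.NumberTheory.EllipticCurves.ModularForms.normalizedPlusSymbol_zero` of `Literature.NumberTheory.EllipticCurves.ModularSymbols`: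

  `[0]⁺_f = normalizedPlusSymbol f 0 = re L(1) / Ω⁺_f`

for every entire continuation `L` of `L(f, s)` (Mazur–Tate–Teitelbaum 1986, §I.8, (8.6):
`[0]⁺ = L(f, 1)/Ω⁺`; Cremona §2.8: (2.8.1) at `s = 1` and the ratio `L(f, 1)/Ω(f)` of (2.8.9),
"`Ω(f)` is twice the least real part of a period of `f`"). Indeed
`[0]⁺ = re (plusSymbol f 0) / Ω⁺_f` by definition, `plusSymbol f 0 = ({∞, 0} + {∞, -0})/2 = {∞, 0}_f`
because `-0 = 0` (`plusSymbol_zero`), and `{∞, 0}_f = L(1)`; the hypothesis of the fact that the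
coefficients `aₙ(f)` are real is not used.

## References

* J. E. Cremona, *Algorithms for modular elliptic curves*, 2nd ed., CUP 1997, §2.8,
  (2.8.1), (2.8.2), (2.8.5), (2.8.9).
* B. Mazur, J. Tate, J. Teitelbaum, *On `p`-adic analogues of the conjectures of Birch and
  Swinnerton-Dyer*, Invent. Math. 84 (1986), 1–48, §I.8, (8.6).
* Ju. I. Manin, *Parabolic points and zeta functions of modular curves*, Izv. Akad. Nauk SSSR 36
  (1972), Thm. 1.3.
* F. Diamond, J. Shurman, *A first course in modular forms*, GTM 228, §5.10.
-/

noncomputable section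

open scoped MatrixGroups ModularForm Real

open CongruenceSubgroup UpperHalfPlane Complex

namespace Literature.NumberTheory.EllipticCurves.ModularForms

section CompletedL

variable {N : ℕ} [NeZero N] (f : CuspForm (Gamma0 N) 2)

/-- For an entire continuation `Λ` of `Λ_N(f, s)`, the function `N^{-s/2} (2π)^s Γ(s)⁻¹ Λ(s)` is
entire (`1/Γ` is entire). [folklore] -/
theorem differentiable_uncompleteL {Λ : ℂ → ℂ} (hΛ : Differentiable ℂ Λ) :
    Differentiable ℂ fun s ↦
      (N : ℂ) ^ (-(s / 2)) * (2 * Real.pi : ℂ) ^ s * (Complex.Gamma s)⁻¹ * Λ s := by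
  intro s
  have hN : (N : ℂ) ≠ 0 := by exact_mod_cast NeZero.ne N
  have h2π : (2 * Real.pi : ℂ) ≠ 0 := by exact_mod_cast Real.two_pi_pos.ne'
  have h1 : DifferentiableAt ℂ (fun s : ℂ ↦ (N : ℂ) ^ (-(s / 2))) s :=
    ((differentiableAt_id.div_const 2).neg).const_cpow (Or.inl hN)
  have h2 : DifferentiableAt ℂ (fun s : ℂ ↦ (2 * Real.pi : ℂ) ^ s) s :=
    differentiableAt_id.const_cpow (Or.inl h2π)
  exact ((h1.mul h2).mul (Complex.differentiable_one_div_Gamma s)).mul (hΛ s)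

/-- For an entire continuation `Λ` of `Λ_N(f, s)` and `re s > 2`,
`N^{-s/2} (2π)^s Γ(s)⁻¹ Λ(s) = L(f, s)` (`Γ(s) ≠ 0` on `re s > 0`; Cremona §2.8, (2.8.5) read
backwards). [cite: CremonaAlgorithms1997, §2.8 (2.8.5)] -/
theorem uncompleteL_eq_cuspFormLSeries {Λ : ℂ → ℂ} (hΛ : Λ ∈ completedCuspFormLContinuations N f)
    {s : ℂ} (hs : 2 < s.re) :
    (N : ℂ) ^ (-(s / 2)) * (2 * Real.pi : ℂ) ^ s * (Complex.Gamma s)⁻¹ * Λ s =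
      cuspFormLSeries f s := by
  have hs' : ((2 : ℤ) : ℝ) / 2 + 1 < s.re := by push_cast; linarith
  rw [hΛ.2 s hs', completedCuspFormL]
  have hN : (N : ℂ) ≠ 0 := by exact_mod_cast NeZero.ne N
  have hΓ : Complex.Gamma s ≠ 0 := Complex.Gamma_ne_zero_of_re_pos (by linarith)
  have hNs : (N : ℂ) ^ (s / 2) ≠ 0 := by
    rw [Ne, cpow_eq_zero_iff, not_and_or]
    exact Or.inl hN
  have h2πs : (2 * Real.pi : ℂ) ^ s ≠ 0 := by
    rw [Ne, cpow_eq_zero_iff, not_and_or]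
    exact Or.inl (by exact_mod_cast Real.two_pi_pos.ne')
  rw [cpow_neg, cpow_neg]
  field_simp

/-- Discharge of `modularSymbol_zero_eq_of_mem_completedCuspFormLContinuations`:
**`{∞, 0}_f = 2π N^{-1/2} Λ(1)`** for every entire continuation `Λ` of the completed
`L`-function `Λ_N(f, s) = N^{s/2} (2π)^{-s} Γ(s) L(f, s)` of `f ∈ S₂(Γ₀(N))`: apply
`{∞, 0}_f = L(1)` (`modularSymbol_zero_eq_holds`, Cremona §2.8: "substituting `s = 1` into
(2.8.1), `L(f, 1) = -2πi ∫₀^{i∞} f(z) dz`") to the entire function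
`L(s) = N^{-s/2} (2π)^s Γ(s)⁻¹ Λ(s)`, which continues `L(f, s)` by (2.8.5), and use `Γ(1) = 1`.
[cite: CremonaAlgorithms1997, §2.8 (2.8.1), (2.8.5)] -/
theorem modularSymbol_zero_eq_of_mem_completedCuspFormLContinuations_holds :
    modularSymbol_zero_eq_of_mem_completedCuspFormLContinuations f := by
  intro Λ hΛ
  rw [modularSymbol_zero_eq_holds f (differentiable_uncompleteL hΛ.1)
    (fun s hs ↦ uncompleteL_eq_cuspFormLSeries f hΛ hs)]
  have hN : (N : ℂ) ≠ 0 := by exact_mod_cast NeZero.ne N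
  simp only [Complex.Gamma_one, inv_one, mul_one, cpow_one, cpow_neg]
  ring

end CompletedL

/-! ### `[0]⁺_f = L(f, 1) / Ω⁺_f` (Mazur–Tate–Teitelbaum §I.8) -/

section NormalizedZero

variable {N : ℕ} (f : CuspForm (Gamma0 N) 2)

/-- `plusSymbol f 0 = {∞, 0}_f`: the plus symbol `({∞, r}_f + {∞, -r}_f)/2` at `r = 0` is the
modular symbol `{∞, 0}_f` itself, since `-0 = 0`. [folklore] -/
theorem plusSymbol_zero : plusSymbol f 0 = modularSymbol f 0 := by
  rw [plusSymbol, neg_zero, ← two_mul, mul_div_cancel_left₀ _ two_ne_zero]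

variable [NeZero N]

/-- Discharge of `normalizedPlusSymbol_zero`: **`[0]⁺_f = re L(f, 1) / Ω⁺_f`** for a weight-`2`
cusp form `f` on `Γ₀(N)` and every entire continuation `L` of `L(f, s) = ∑ aₙ n⁻ˢ`
(Mazur–Tate–Teitelbaum 1986, §I.8, (8.6): `[0]⁺ = L(f, 1)/Ω⁺`; Cremona §2.8: "substituting `s = 1`
into (2.8.1), `L(f, 1) = -2πi ∫₀^{i∞} f(z) dz = -⟨{0, ∞}, f⟩`", and the ratio `L(f, 1)/Ω(f)` of
(2.8.9)). Proof: `[0]⁺_f = re (plusSymbol f 0) / Ω⁺_f` by definition, `plusSymbol f 0 = {∞, 0}_f`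
(`plusSymbol_zero`) and `{∞, 0}_f = L(1)` (`modularSymbol_zero_eq_holds`, Hecke's continuation
plus the identity theorem); the hypothesis of the fact that all `aₙ(f)` are real is not needed.
[cite: MazurTateTeitelbaum1986Invent, §I.8 (8.6)] -/
theorem normalizedPlusSymbol_zero_holds : normalizedPlusSymbol_zero (f := f) := by
  intro _ L hL hL'
  rw [normalizedPlusSymbol, plusSymbol_zero, modularSymbol_zero_eq_holds f hL hL']

end NormalizedZero

end Literature.NumberTheory.EllipticCurves.ModularForms
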